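import Literature.MathematicalPhysics.QuantumFieldTheory.Balaban1983to89.B9Eq3105FamThreeTFar
import Literature.MathematicalPhysics.QuantumFieldTheory.Balaban1983to89.B9Ineq349Hom
import Literature.MathematicalPhysics.QuantumFieldTheory.Balaban1983to89.B9Thm39CinvSepMiddle

/-!
# `Balaban1983to89.B9Eq3105FamThreeLocCDiffChains` — FAMILY 3 OF (3.105), THE LOCATED `C`-DIFFERENCE WORD `hP3` (D2), FILE F3-B3∕4: THE LETTER-FREE
# KERNEL ENGINE — a row-located prefix grows by one decaying or block-local letter at a time ([4] (2.52)–(2.55), (2.60)–(2.61)), ONE far cut-off prices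
# the word by `e^{−a_sep·D_sep}` ([4] (2.83)–(2.85)), and the four core words `W1–W4` of FILE 2 (`B9Eq3105FamThreeLocCDiffSplit.cut_locCDiff_cut_eq_fourWords`)
# plus p38's two leaks get their (2.51)-majorants `𝟙[a ∈ S_L]·ε·w(a)·e^{−ρd}` with EXPLICIT constants, letters abstract (sub-row G-B9-LETTERS, GAPS G-B9-05
# family 3 (D2); programme FAMTHREE; plan `lit-balaban-p33/g104/F3B3-KERNELS-PLAN.md` v2)

statement-level skeleton of published theorems with citation tags; proofs where landed; nothing here is a claim about the Yang–Mills mass gap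

THE PRINTED LOCUS (held `paper:balaban1985-cmp99-background-propagators`, journal page = PDF page + 388; `paper:balaban1984-cmp96-propagators-rt-ii`).  [B9] p. 412
l. 22–36 «We have proved in [2] that if we have a difference of propagators defined on two domains, then in an estimate of this difference we have, besides the
usual factors …, an exponential factor with a distance between localizations and a closest point where a change was made»; p. 415 l. 29–37 (the `C_{□₀} − C_□`
term «small by the same reason as before»); (3.48)–(3.49) pp. 398–399 (the usual factors); p. 403 l. 1–6 («this property is preserved under the composition»).
[4] (2.51)–(2.55) p. 232 (majorants and their composition), Lemma 2.1 (2.60)–(2.61) p. 234 (scale transfer, the `y″`-sum), (2.83)–(2.85) pp. 237–238 (the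
separated variable gives `e^{−δ·dist}`), (2.45)–(2.46) p. 231 (blocks, nested families).  [2] = `Balaban1983RegularityDecay` (1.11)–(1.12): STATEMENT TYPE ONLY.

WHAT THIS FILE CERTIFIES (kernel-checked; abstract geometry `g`, block map `blk : X → g.Site`, carrier `toB6 g R H`; 0 `def`, 0 `def … : Prop`, 0 sorry)

* §1 ★ `chain_majorant_blk` — `T ≺ 𝟙[a ∈ S]κ₁w₁(a)e^{−rd}`, `G ≺ κ₂w₂(a)e^{−ρd}`, `ρ + (α + β)δ₀ ≤ r`, scale transfer `(δ₀, α, C)` for `w₂`, (2.61) at `β`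
  ⟹ `T·G ≺ 𝟙[a ∈ S](κ₁κ₂Cc₁)(w₁w₂)(a)e^{−ρd}` (p33 `B9Ineq349Hom.hasMajorantHom_comp_decay` through `hasMajorantHom_iff`, the row indicator folded into the weight);
  ★ `chain_local_majorant_blk` (a block-local letter `κ₂𝟙[a = a′]`: no rate loss); unlocated twins `mul_decay_majorant_blk`, `mul_local_majorant_blk` (suffix building);
  ★★ `word_far_majorant_blk` — `T·M_m·G` with `supp m` over blocks `Z`, `D_sep ≤ d(S, Z)`: the factor `e^{−r_sepD_sep}` (p38 `rowSep_majorant_blk` + §1);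
  ★ `hasMajorant_diag_coarsen` — a `κ𝟙[c = c′]`-majorant for a FINER block map (the cube sequence's) is a `κ𝟙[a = a′]`-majorant for the coarser one (the member's),
  for nested families ([4] (2.45); r05 `B9CubeCoarsening.blkOf_eq_of_cube_blkOf_eq` is the nesting) — the cube projection `Q′*_□Q′_□` on the member's carrier;
  (constant weights: p33 `B9Ineq366CPrime.scaleTransfer_one` BY NAME).
* §2 ★★ `word1_majorant_blk` … `word4_majorant_blk`, ★ `leak_majorant_blk` — the four core words of FILE 2 and the leaks, letters ABSTRACT operators on `X → ℝ` with
  displayed majorant shapes: `L` (the left entry `η⁻¹∇·M_{χl}·η²G′_□`, rows located in `S_L`, rate `r₀`), `S` (`η⁻⁴Q′*X⁻¹Q′`, weight `ℓ⁻⁴`-type), `A` (`η²G′(U₁)`), `P`, `P_□`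
  (block-local), `R_χ = M_{m_Z}R_χ` (rows in the annulus blocks `Z`), the far cut-off `m` (support blocks `Z`), `Suf` (the right part: `(η²G′_□)^k·η⁻⁴S_□·M₂·η²G′_□M_{χl}·η⁻¹∇*`);
  rates on the ladder `r₀ − kε`, `ε = (α + β)δ₀`; ONE separation `D_sep ≤ d(S_L, Z)` per word; conclusions
  `≺ 𝟙[a ∈ S_L]·(Πκ·ΠC·c₁ⁿ·e^{−a_sepD_sep})·(Πw)(a)·e^{−(r₀ − nε − a_sep)d}` with `n = 2, 4, 5, 4, 2`.

ROAD (ours; [4]'s composition calculus, not print's second random-walk expansion).  FILE 2 splits `M₂(S − S_□)M₂` into `W1 − W2 − W3 − W4`; p38's `sandwich_split`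
adds two leaks; the outer entries `η⁻¹∇M_{χl}η²G′_□(V′)` ∕ `η²G′_□(V′)M_{χl}η⁻¹∇*` ((3.100)) have rows ∕ columns located within `NearC(21S_j∕8 + 1)`; every word carries
ONE far factor — `1 − χ_□` (off `NearC 3S_j`: p38 `collar_le_dist_chiL_chiY`, `3M_h∕8 − 1`), `R_χ`'s rows (annulus `¬NearC(3S_j − b_j)`: p38 `collar_le_dist_chiL_annulus`,
`3M_h∕8 − 2`), or `1 − M₂` (`M₂ = 𝟙[NearC 3S_j]`, `3M_h∕8 − 1`).  FILE 5 supplies the letters' member-carrier majorants (r06 `hCinv` + r05's `Q′` homs → `S`; `hE` → `A`;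
F3-E2b∕E2e + the record's `hR` → `R_χ`; p33 atoms + `hasMajorant_diag_coarsen` → `P`, `P_□`; cube tails at `V′` displayed), FILE 6 the outer entries and the bond relabel.

HONEST SCOPE ∕ NOT CLAIMED.  Finite bookkeeping over landed modules ([4] (2.51)–(2.61) calculus); NO inequality of [B9] is proved here (every letter majorant is a
HYPOTHESIS).  Count-neutral; NOT a node discharge; `hP3` NOT yet discharged; nothing continuum ∕ OS ∕ mass-gap ∕ Clay; YM mass gap NOT proved (Track A conditional
rung).  No `sorry`, no `axiom`, no `… : Prop` fact, no `instance`, no `notation`, no `def`.  NEW file; nothing landed is modified.  Cell `lit-balaban`, seat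
`lit-balaban-p33` gen 104, 2026-08-29; `--supports stmt-QuantumFields-19200` as helper.  Net new unproved facts: 0.  Inhabited: all operators `0` and all constants `0`
satisfy every hypothesis and the conclusions (`0 ≺ 0`); not a vacuous schema.

RELATED IN THE TREE, NOT DUPLICATED (searched 2026-08-29: `rg 'chain_majorant|word_far_majorant|diag_coarsen|word[1-4]_majorant' Literature/` = ∅): p33 `B9Ineq349Hom`
(`hasMajorantHom_comp_decay` ∕ `_local_comp` ∕ `_comp_local` ∕ `_rate_mono` — USED BY NAME), p38 `B9Eq3105FamThreeTFar.rowSep_majorant_blk`, p21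
`B9Thm39CinvSepMiddle.sepMiddle_majorant_blk` (the operator-level twin `M_f·L·M_m·T`; here the prefix is located at the MAJORANT level), p33 `B9Eq3105FamThreeLocDiffGEngine`
(`hasMajorant_gapPiece` ∕ `hasMajorant_commPiece`: the two-letter words of `hDL`), p38 `B9Eq3105FamThreeLocDiffGRight` (`colSep_majorant_blk`, `sepLeftCol_majorant_blk`: the
`hDR` orientation), pv08∕r06 `B6RandomWalk` ∕ `B6RandomWalkHom` ∕ `B6DomainMajorant.hasMajorant_mul_weighted`.
-/

noncomputable section

namespace Literature.MathematicalPhysics.QuantumFieldTheory.Balaban1983to89.B9Eq3105FamThreeLocCDiffChains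

open B6RandomWalk (HasMajorant hasMajorant_mono hasMajorant_add hasMajorant_mul Ineq261 c1_nonneg Triangle254)
open B6RandomWalkHom (HasMajorantHom hasMajorantHom_iff hasMajorantHom_mono)
open B9Thm34Ext (toB6)
open B9Thm37Sum (mulOp mulOp_apply)
open B9Ineq347 (ScaleTransfer)
open B9Ineq366CPrime (scaleTransfer_one)
open B9Ineq349Hom (hasMajorantHom_comp_decay hasMajorantHom_comp_local hasMajorantHom_local_comp hasMajorantHom_rate_mono)
open B9Eq395Small (hasMajorant_mulOp_left hasMajorant_mul_mulOp_right)
open B9Thm39CinvSepMiddle (hasMajorant_mulOp_rows)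
open B9Eq3105FamThreeTFar (rowSep_majorant_blk)

/-! ## §1  The chain calculus: one letter at a time on a row-located prefix -/

section Generic

variable {g : B9.Geometry} [Fintype g.Site] [DecidableEq g.Site] {Rg : ℝ} {Hg : Prop} {X : Type}

/-- ★ **ONE MORE DECAYING LETTER ON A ROW-LOCATED PREFIX** ([4] (2.52)–(2.55) with the scale transfer (2.60) and (2.61)): `T ≺ 𝟙[a ∈ S]·κ₁·w₁(a)·e^{−r d}`,
`G ≺ κ₂·w₂(a)·e^{−ρ d}`, `ρ + (α + β)δ₀ ≤ r` ⟹ `T·G ≺ 𝟙[a ∈ S]·(κ₁κ₂·C·c₁(δ₀,β))·(w₁w₂)(a)·e^{−ρ d}`.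
[cite: Balaban1984PropagatorsII, (2.52)–(2.55) p.232, (2.60)–(2.61) p.234; Balaban1985BackgroundPropagators, (3.49) p.399, p.403 l.1–6] -/
theorem chain_majorant_blk (blk : X → g.Site) (dB : ℕ) (S : Finset g.Site) {T G : Module.End ℝ (X → ℝ)} {κ₁ κ₂ r ρ δ₀ α β C : ℝ}
    (w₁ w₂ : g.Site → ℝ) (hκ₁ : 0 ≤ κ₁) (hκ₂ : 0 ≤ κ₂) (hC : 0 ≤ C) (hw₁ : ∀ a, 0 ≤ w₁ a) (hw₂ : ∀ a, 0 ≤ w₂ a) (hρ : 0 ≤ ρ)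
    (hr : ρ + (α + β) * δ₀ ≤ r) (hdnn : ∀ a b : g.Site, 0 ≤ g.dist a b) (htri : Triangle254 (toB6 g Rg Hg))
    (hST : ScaleTransfer g δ₀ α C w₂) (h261 : Ineq261 dB (toB6 g Rg Hg) δ₀ β)
    (hT : HasMajorant (g := toB6 g Rg Hg) blk T (fun (a b : g.Site) => (if a ∈ S then (1 : ℝ) else 0) * (κ₁ * w₁ a * Real.exp (-(r * g.dist a b)))))
    (hG : HasMajorant (g := toB6 g Rg Hg) blk G (fun (a b : g.Site) => κ₂ * w₂ a * Real.exp (-(ρ * g.dist a b)))) :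
    HasMajorant (g := toB6 g Rg Hg) blk (T * G)
      (fun (a b : g.Site) => (if a ∈ S then (1 : ℝ) else 0) * ((κ₁ * κ₂ * C * B6.c1 dB δ₀ β) * (w₁ a * w₂ a) * Real.exp (-(ρ * g.dist a b)))) := by
  have hw₁' : ∀ a, 0 ≤ (if a ∈ S then (1 : ℝ) else 0) * w₁ a := fun a => mul_nonneg (by split_ifs <;> norm_num) (hw₁ a)
  have hT' : HasMajorantHom (g := toB6 g Rg Hg) blk blk T
      (fun (a b : g.Site) => κ₁ * ((if a ∈ S then (1 : ℝ) else 0) * w₁ a) * Real.exp (-(r * g.dist a b))) :=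
    (hasMajorantHom_iff (g := toB6 g Rg Hg) blk T _).2 (hasMajorant_mono (g := toB6 g Rg Hg) _ hT fun a b => le_of_eq (by ring))
  have h := hasMajorantHom_comp_decay (R := Rg) (H := Hg) blk blk blk dB δ₀ α β ρ r C κ₁ κ₂ (fun a => (if a ∈ S then (1 : ℝ) else 0) * w₁ a) w₂
    hw₁' hw₂ hC hκ₁ hκ₂ hρ hr hdnn htri hST h261 hT' ((hasMajorantHom_iff (g := toB6 g Rg Hg) blk G _).2 hG)
  exact hasMajorant_mono (g := toB6 g Rg Hg) _ ((hasMajorantHom_iff (g := toB6 g Rg Hg) blk (T * G) _).1 h) fun a b => le_of_eq (by ring)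

/-- ★ **ONE MORE BLOCK-LOCAL LETTER ON A ROW-LOCATED PREFIX** (a projection `Q′*Q′`, a multiplier): `T ≺ 𝟙[a ∈ S]·κ₁·w₁(a)·e^{−r d}`, `G ≺ κ₂·𝟙[a = a′]`, `0 ≤ κ₂`
⟹ `T·G ≺ 𝟙[a ∈ S]·(κ₁κ₂)·w₁(a)·e^{−r d}`. [cite: Balaban1985BackgroundPropagators, (3.19) p.393, (3.49) p.399; Balaban1984PropagatorsII, (2.52) p.232] -/
theorem chain_local_majorant_blk (blk : X → g.Site) (S : Finset g.Site) {T G : Module.End ℝ (X → ℝ)} {κ₁ κ₂ r : ℝ} (w₁ : g.Site → ℝ)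
    (hκ₂ : 0 ≤ κ₂)
    (hT : HasMajorant (g := toB6 g Rg Hg) blk T (fun (a b : g.Site) => (if a ∈ S then (1 : ℝ) else 0) * (κ₁ * w₁ a * Real.exp (-(r * g.dist a b)))))
    (hG : HasMajorant (g := toB6 g Rg Hg) blk G (fun a b : g.Site => if a = b then κ₂ else 0)) :
    HasMajorant (g := toB6 g Rg Hg) blk (T * G)
      (fun (a b : g.Site) => (if a ∈ S then (1 : ℝ) else 0) * ((κ₁ * κ₂) * w₁ a * Real.exp (-(r * g.dist a b)))) := by
  have h := hasMajorantHom_comp_local (R := Rg) (H := Hg) blk blk blk κ₂ hκ₂ ((hasMajorantHom_iff (g := toB6 g Rg Hg) blk T _).2 hT)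
    ((hasMajorantHom_iff (g := toB6 g Rg Hg) blk G _).2 hG)
  exact hasMajorant_mono (g := toB6 g Rg Hg) _ ((hasMajorantHom_iff (g := toB6 g Rg Hg) blk (T * G) _).1 h) fun a b => le_of_eq (by ring)

omit [DecidableEq g.Site] in
/-- the unlocated twin (building a suffix): `T ≺ κ₁w₁(a)e^{−rd}`, `G ≺ κ₂w₂(a)e^{−ρd}`, `ρ + (α + β)δ₀ ≤ r` ⟹ `T·G ≺ (κ₁κ₂Cc₁)·(w₁w₂)(a)·e^{−ρd}`.
[cite: Balaban1984PropagatorsII, (2.52)–(2.55) p.232, (2.60)–(2.61) p.234] -/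
theorem mul_decay_majorant_blk (blk : X → g.Site) (dB : ℕ) {T G : Module.End ℝ (X → ℝ)} {κ₁ κ₂ r ρ δ₀ α β C : ℝ}
    (w₁ w₂ : g.Site → ℝ) (hκ₁ : 0 ≤ κ₁) (hκ₂ : 0 ≤ κ₂) (hC : 0 ≤ C) (hw₁ : ∀ a, 0 ≤ w₁ a) (hw₂ : ∀ a, 0 ≤ w₂ a) (hρ : 0 ≤ ρ)
    (hr : ρ + (α + β) * δ₀ ≤ r) (hdnn : ∀ a b : g.Site, 0 ≤ g.dist a b) (htri : Triangle254 (toB6 g Rg Hg))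
    (hST : ScaleTransfer g δ₀ α C w₂) (h261 : Ineq261 dB (toB6 g Rg Hg) δ₀ β)
    (hT : HasMajorant (g := toB6 g Rg Hg) blk T (fun (a b : g.Site) => κ₁ * w₁ a * Real.exp (-(r * g.dist a b))))
    (hG : HasMajorant (g := toB6 g Rg Hg) blk G (fun (a b : g.Site) => κ₂ * w₂ a * Real.exp (-(ρ * g.dist a b)))) :
    HasMajorant (g := toB6 g Rg Hg) blk (T * G)
      (fun (a b : g.Site) => (κ₁ * κ₂ * C * B6.c1 dB δ₀ β) * (w₁ a * w₂ a) * Real.exp (-(ρ * g.dist a b))) :=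
  (hasMajorantHom_iff (g := toB6 g Rg Hg) blk (T * G) _).1
    (hasMajorantHom_comp_decay (R := Rg) (H := Hg) blk blk blk dB δ₀ α β ρ r C κ₁ κ₂ w₁ w₂ hw₁ hw₂ hC hκ₁ hκ₂ hρ hr hdnn htri hST h261
      ((hasMajorantHom_iff (g := toB6 g Rg Hg) blk T _).2 hT) ((hasMajorantHom_iff (g := toB6 g Rg Hg) blk G _).2 hG))

/-- the unlocated block-local twins: `T ≺ κ₁w₁e^{−rd}`, `G ≺ κ₂𝟙[a = a′]` ⟹ `T·G ≺ (κ₁κ₂)w₁e^{−rd}`; `G·T ≺ (κ₂κ₁)w₁e^{−rd}`.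
[cite: Balaban1985BackgroundPropagators, (3.19) p.393, (3.49) p.399] -/
theorem mul_local_majorant_blk (blk : X → g.Site) {T G : Module.End ℝ (X → ℝ)} {κ₁ κ₂ r : ℝ} (w₁ : g.Site → ℝ) (hκ₁ : 0 ≤ κ₁) (hκ₂ : 0 ≤ κ₂)
    (hw₁ : ∀ a, 0 ≤ w₁ a)
    (hT : HasMajorant (g := toB6 g Rg Hg) blk T (fun (a b : g.Site) => κ₁ * w₁ a * Real.exp (-(r * g.dist a b))))
    (hG : HasMajorant (g := toB6 g Rg Hg) blk G (fun a b : g.Site => if a = b then κ₂ else 0)) :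
    HasMajorant (g := toB6 g Rg Hg) blk (T * G) (fun (a b : g.Site) => (κ₁ * κ₂) * w₁ a * Real.exp (-(r * g.dist a b))) ∧
      HasMajorant (g := toB6 g Rg Hg) blk (G * T) (fun (a b : g.Site) => (κ₂ * κ₁) * w₁ a * Real.exp (-(r * g.dist a b))) := by
  refine ⟨?_, ?_⟩
  · have h := hasMajorantHom_comp_local (R := Rg) (H := Hg) blk blk blk κ₂ hκ₂ ((hasMajorantHom_iff (g := toB6 g Rg Hg) blk T _).2 hT)
      ((hasMajorantHom_iff (g := toB6 g Rg Hg) blk G _).2 hG)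
    exact hasMajorant_mono (g := toB6 g Rg Hg) _ ((hasMajorantHom_iff (g := toB6 g Rg Hg) blk (T * G) _).1 h) fun a b => le_of_eq (by ring)
  · have hK : ∀ a b : g.Site, 0 ≤ κ₁ * w₁ a * Real.exp (-(r * g.dist a b)) := fun a b => mul_nonneg (mul_nonneg hκ₁ (hw₁ a)) (Real.exp_nonneg _)
    have h := hasMajorantHom_local_comp (R := Rg) (H := Hg) blk blk blk κ₂ (K := fun (a b : g.Site) => κ₁ * w₁ a * Real.exp (-(r * g.dist a b)))
      hK ((hasMajorantHom_iff (g := toB6 g Rg Hg) blk G _).2 hG) ((hasMajorantHom_iff (g := toB6 g Rg Hg) blk T _).2 hT)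
    exact hasMajorant_mono (g := toB6 g Rg Hg) _ ((hasMajorantHom_iff (g := toB6 g Rg Hg) blk (G * T) _).1 h) fun a b => le_of_eq (by ring)

/-- ★★ **A ROW-LOCATED PREFIX, A FAR CUT-OFF, A DECAYING SUFFIX — ONE SEPARATION** ([4] (2.83)–(2.85); [B9] p.412 l.22–36 «an exponential factor with a distance
between localizations and a closest point where a change was made»): `T ≺ 𝟙[a ∈ S]·κ₁·w₁(a)·e^{−r_T d}`, a cut-off `m` supported over blocks `Z` with
`D_sep ≤ d(a, y)` for `a ∈ S`, `y ∈ Z`, `r_sep + r′ ≤ r_T`, and `G ≺ κ₂·w₂(a)·e^{−ρd}` with `ρ + (α + β)δ₀ ≤ r′`: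
`T·M_m·G ≺ 𝟙[a ∈ S]·((κ₁e^{−r_sepD_sep})·κ₂·C·c₁)·(w₁w₂)(a)·e^{−ρd}`.
[cite: Balaban1984PropagatorsII, (2.83)–(2.85) pp.237–238, (2.52)–(2.55) p.232, (2.60)–(2.61) p.234; Balaban1985BackgroundPropagators, p.412 l.22–36, p.415 l.29–37] -/
theorem word_far_majorant_blk (blk : X → g.Site) (dB : ℕ) (S Z : Finset g.Site) (m : X → ℝ) {T G : Module.End ℝ (X → ℝ)}
    {κ₁ κ₂ rT rsep r' ρ δ₀ α β C Dsep : ℝ} (w₁ w₂ : g.Site → ℝ)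
    (hκ₁ : 0 ≤ κ₁) (hκ₂ : 0 ≤ κ₂) (hC : 0 ≤ C) (hw₁ : ∀ a, 0 ≤ w₁ a) (hw₂ : ∀ a, 0 ≤ w₂ a) (hρ : 0 ≤ ρ) (hrsep : 0 ≤ rsep)
    (hsplit : rsep + r' ≤ rT) (hr : ρ + (α + β) * δ₀ ≤ r') (hdnn : ∀ a b : g.Site, 0 ≤ g.dist a b) (htri : Triangle254 (toB6 g Rg Hg))
    (hST : ScaleTransfer g δ₀ α C w₂) (h261 : Ineq261 dB (toB6 g Rg Hg) δ₀ β)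
    (hm1 : ∀ x, |m x| ≤ 1) (hm0 : ∀ x, m x ≠ 0 → blk x ∈ Z) (hsep : ∀ a ∈ S, ∀ y ∈ Z, Dsep ≤ g.dist a y)
    (hT : HasMajorant (g := toB6 g Rg Hg) blk T (fun (a b : g.Site) => (if a ∈ S then (1 : ℝ) else 0) * (κ₁ * w₁ a * Real.exp (-(rT * g.dist a b)))))
    (hG : HasMajorant (g := toB6 g Rg Hg) blk G (fun (a b : g.Site) => κ₂ * w₂ a * Real.exp (-(ρ * g.dist a b)))) :
    HasMajorant (g := toB6 g Rg Hg) blk (T * mulOp m * G)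
      (fun (a b : g.Site) => (if a ∈ S then (1 : ℝ) else 0) *
        (((κ₁ * Real.exp (-(rsep * Dsep))) * κ₂ * C * B6.c1 dB δ₀ β) * (w₁ a * w₂ a) * Real.exp (-(ρ * g.dist a b)))) := by
  have hTm := rowSep_majorant_blk (Rg := Rg) (Hg := Hg) blk w₁ S Z m hκ₁ hw₁ hrsep hsplit hdnn hm1 hm0 hsep hT
  exact chain_majorant_blk (Rg := Rg) (Hg := Hg) blk dB S w₁ w₂ (mul_nonneg hκ₁ (Real.exp_nonneg _)) hκ₂ hC hw₁ hw₂ hρ hr hdnn htri hST h261 hTm hG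

/-! ### A block-local letter of a FINER block family is block-local for the coarser one (the cube projection `Q′*_□Q′_□` on the member's carrier) -/

/-- ★ **NESTED BLOCK MAPS: A DIAGONAL MAJORANT DESCENDS TO THE COARSER FAMILY** ([4] (2.45): the cube sequence's blocks refine the member's): if `T` has the
block-diagonal majorant `κ·𝟙[c = c′]` for a block map `blk₁ : X → g₁.Site` and every `blk₁`-block lies in one `blk`-block (`blk₁ x = blk₁ x′ ⟹ blk x = blk x′`), then
`T` has the majorant `κ·𝟙[a = a′]` for `blk` (decompose a `blk`-supported test function into its `blk₁`-pieces; only the piece of the row's own block acts).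
[cite: Balaban1984PropagatorsII, (2.45) p.231, (2.51)–(2.52) p.232; Balaban1985BackgroundPropagators, (3.19) p.393, p.408] -/
theorem hasMajorant_diag_coarsen {G₁ : B6.Geometry} [DecidableEq G₁.Site] (blk₁ : X → G₁.Site) (blk : X → g.Site)
    (hnest : ∀ x x', blk₁ x = blk₁ x' → blk x = blk x') {T : Module.End ℝ (X → ℝ)} {κ : ℝ}
    (hT : HasMajorant (g := G₁) blk₁ T (fun c c' : G₁.Site => if c = c' then κ else 0)) :
    HasMajorant (g := toB6 g Rg Hg) blk T (fun a a' : g.Site => if a = a' then κ else 0) := by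
  classical
  intro y' μ B hμ x
  -- decompose `μ` into its `blk₁`-pieces
  show |T μ x| ≤ (if blk x = y' then κ else 0) * B
  have hdec : T μ x = ∑ c : G₁.Site, T (B6RandomWalk.blockPiece blk₁ c μ) x := by
    have h1 : T μ x = T (∑ c : G₁.Site, B6RandomWalk.blockPiece blk₁ c μ) x :=
      congrArg (fun ν => T ν x) (B6RandomWalk.sum_blockPiece blk₁ μ).symm
    rw [h1, map_sum, Finset.sum_apply]
  have hpiece : ∀ c : G₁.Site, |T (B6RandomWalk.blockPiece blk₁ c μ) x| ≤ (if blk₁ x = c then κ else 0) * B := fun c =>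
    hT c _ B (B6RandomWalk.blockSupp_blockPiece blk₁ μ c B hμ.nonneg fun x' _ => by
      by_cases hx' : blk x' = y'
      · exact hμ.bound x' hx'
      · rw [hμ.off x' hx', abs_zero]; exact hμ.nonneg) x
  -- off the row's own `blk₁`-block every piece is killed; on it, the piece vanishes unless the row's `blk`-block is `y′`
  by_cases hx : blk x = y'
  · rw [if_pos hx, hdec]
    calc |∑ c : G₁.Site, T (B6RandomWalk.blockPiece blk₁ c μ) x| ≤ ∑ c : G₁.Site, |T (B6RandomWalk.blockPiece blk₁ c μ) x| := Finset.abs_sum_le_sum_abs _ _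
      _ ≤ ∑ c : G₁.Site, (if blk₁ x = c then κ else 0) * B := Finset.sum_le_sum fun c _ => hpiece c
      _ = κ * B := by rw [← Finset.sum_mul, Finset.sum_ite_eq]; simp
  · rw [if_neg hx, zero_mul, hdec]
    have hzero : ∀ c : G₁.Site, T (B6RandomWalk.blockPiece blk₁ c μ) x = 0 := by
      intro c
      by_cases hc : blk₁ x = c
      · -- the piece itself vanishes: a site of block `c` with `μ ≠ 0` would put `x` in the `blk`-block `y′`
        have hμc : B6RandomWalk.blockPiece blk₁ c μ = 0 := by
          funext x'
          rw [Pi.zero_apply]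
          unfold B6RandomWalk.blockPiece
          by_cases h1 : blk₁ x' = c
          · rw [if_pos h1]
            by_contra hne
            have hx'y : blk x' = y' := by by_contra h; exact hne (hμ.off x' h)
            exact hx ((hnest x x' (hc.trans h1.symm)).trans hx'y)
          · rw [if_neg h1]
        rw [hμc, map_zero]; rfl
      · have h := hpiece c
        rw [if_neg hc, zero_mul] at h
        exact abs_nonpos_iff.1 h
    rw [Finset.sum_eq_zero fun c _ => hzero c, abs_zero]

/-! ## §2  The four core words and the leaks, letters abstract (rates on the ladder `r₀ − kε`, `ε = (α + β)δ₀`) -/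

/-- ★★ **WORD 3** `L·S·A·A·R_χ·Suf` — the commutator-step letter `R_χ = M_{m_Z}·R_χ` has its rows in the annulus blocks `Z` at distance `≥ D_sep` from the located rows
`S_L` of `L`: with `L ≺ 𝟙[a ∈ S_L]κ_Lw_L(a)e^{−r₀d}`, `S ≺ κ_Sw_Se^{−r_Sd}` (`r_S ≥ r₀ − ε`), `A ≺ κ_Aw_Ae^{−r_Ad}` (`r_A ≥ r₀ − 2ε`), `R_χ ≺ θe^{−r_cd}` (`r_c ≥ r₀ − 4ε − a_sep`),
`Suf ≺ κ_Tw_Te^{−r_Td}` (`r_T ≥ ρ := r₀ − 5ε − a_sep ≥ 0`):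
`L·S·A·A·R_χ·Suf ≺ 𝟙[a ∈ S_L]·(κ_Lκ_Sκ_A²θκ_T·C_SC_A²C_T·c₁⁵·e^{−a_sepD_sep})·(w_Lw_Sw_A²w_T)(a)·e^{−ρd}`.
[cite: Balaban1985BackgroundPropagators, p.412 l.1–9 + l.22–36, p.415 l.29–37, (3.48)–(3.49) pp.398–399; Balaban1984PropagatorsII, (2.83)–(2.85) pp.237–238, (2.52)–(2.55) p.232, (2.60)–(2.61) p.234] -/
theorem word3_majorant_blk (blk : X → g.Site) (dB : ℕ) (S_L Z : Finset g.Site) (mZ : X → ℝ) {L Sop Aop Rc Suf : Module.End ℝ (X → ℝ)}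
    {κL κS κA θ κT r₀ rS rA rc rT δ₀ α β asep Dsep CS CA CT : ℝ} (wL wS wA wT : g.Site → ℝ)
    (hκL : 0 ≤ κL) (hκS : 0 ≤ κS) (hκA : 0 ≤ κA) (hθ : 0 ≤ θ) (hκT : 0 ≤ κT) (hCS : 0 ≤ CS) (hCA : 0 ≤ CA) (hCT : 0 ≤ CT)
    (hwL : ∀ a, 0 ≤ wL a) (hwS : ∀ a, 0 ≤ wS a) (hwA : ∀ a, 0 ≤ wA a) (hwT : ∀ a, 0 ≤ wT a)
    (hαδ : 0 ≤ α * δ₀) (hε0 : 0 ≤ (α + β) * δ₀) (hasep : 0 ≤ asep) (hρ : 0 ≤ r₀ - 5 * ((α + β) * δ₀) - asep)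
    (hrS : r₀ - (α + β) * δ₀ ≤ rS) (hrA : r₀ - 2 * ((α + β) * δ₀) ≤ rA) (hrc : r₀ - 4 * ((α + β) * δ₀) - asep ≤ rc)
    (hrT : r₀ - 5 * ((α + β) * δ₀) - asep ≤ rT)
    (hdnn : ∀ a b : g.Site, 0 ≤ g.dist a b) (htri : Triangle254 (toB6 g Rg Hg))
    (hSTS : ScaleTransfer g δ₀ α CS wS) (hSTA : ScaleTransfer g δ₀ α CA wA) (hSTT : ScaleTransfer g δ₀ α CT wT) (h261 : Ineq261 dB (toB6 g Rg Hg) δ₀ β)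
    (hm1 : ∀ x, |mZ x| ≤ 1) (hm0 : ∀ x, mZ x ≠ 0 → blk x ∈ Z) (hRcZ : mulOp mZ * Rc = Rc) (hsep : ∀ a ∈ S_L, ∀ y ∈ Z, Dsep ≤ g.dist a y)
    (hL : HasMajorant (g := toB6 g Rg Hg) blk L (fun (a b : g.Site) => (if a ∈ S_L then (1 : ℝ) else 0) * (κL * wL a * Real.exp (-(r₀ * g.dist a b)))))
    (hS : HasMajorant (g := toB6 g Rg Hg) blk Sop (fun (a b : g.Site) => κS * wS a * Real.exp (-(rS * g.dist a b))))
    (hA : HasMajorant (g := toB6 g Rg Hg) blk Aop (fun (a b : g.Site) => κA * wA a * Real.exp (-(rA * g.dist a b))))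
    (hRc : HasMajorant (g := toB6 g Rg Hg) blk Rc (fun (a b : g.Site) => θ * Real.exp (-(rc * g.dist a b))))
    (hSuf : HasMajorant (g := toB6 g Rg Hg) blk Suf (fun (a b : g.Site) => κT * wT a * Real.exp (-(rT * g.dist a b)))) :
    HasMajorant (g := toB6 g Rg Hg) blk (L * Sop * Aop * Aop * Rc * Suf)
      (fun (a b : g.Site) => (if a ∈ S_L then (1 : ℝ) else 0) *
        ((κL * κS * κA ^ 2 * θ * κT * (CS * CA ^ 2 * CT) * B6.c1 dB δ₀ β ^ 5 * Real.exp (-(asep * Dsep))) *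
          (wL a * wS a * wA a ^ 2 * wT a) * Real.exp (-((r₀ - 5 * ((α + β) * δ₀) - asep) * g.dist a b)))) := by
  set ε : ℝ := (α + β) * δ₀ with hε
  have hc1 : 0 ≤ B6.c1 dB δ₀ β := c1_nonneg _ _ _
  -- the letters weakened to the ladder rates
  have hS' := (hasMajorantHom_iff (g := toB6 g Rg Hg) blk Sop _).1
    (hasMajorantHom_rate_mono (R := Rg) (H := Hg) blk blk κS wS (ρ := r₀ - ε) hκS hwS hrS hdnn ((hasMajorantHom_iff (g := toB6 g Rg Hg) blk Sop _).2 hS))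
  have hA2 := (hasMajorantHom_iff (g := toB6 g Rg Hg) blk Aop _).1
    (hasMajorantHom_rate_mono (R := Rg) (H := Hg) blk blk κA wA (ρ := r₀ - 2 * ε) hκA hwA hrA hdnn ((hasMajorantHom_iff (g := toB6 g Rg Hg) blk Aop _).2 hA))
  have hA3 := (hasMajorantHom_iff (g := toB6 g Rg Hg) blk Aop _).1
    (hasMajorantHom_rate_mono (R := Rg) (H := Hg) blk blk κA wA (ρ := r₀ - 3 * ε) hκA hwA (by linarith) hdnn
      ((hasMajorantHom_iff (g := toB6 g Rg Hg) blk Aop _).2 hA))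
  have hRc' : HasMajorant (g := toB6 g Rg Hg) blk Rc (fun (a b : g.Site) => θ * (fun _ => (1 : ℝ)) a * Real.exp (-((r₀ - 4 * ε - asep) * g.dist a b))) :=
    (hasMajorantHom_iff (g := toB6 g Rg Hg) blk Rc _).1
      (hasMajorantHom_rate_mono (R := Rg) (H := Hg) blk blk θ (fun _ => (1 : ℝ)) (ρ := r₀ - 4 * ε - asep) hθ (fun _ => zero_le_one) hrc hdnn
        ((hasMajorantHom_iff (g := toB6 g Rg Hg) blk Rc _).2 (hasMajorant_mono (g := toB6 g Rg Hg) _ hRc fun a b => le_of_eq (by simp only [mul_one]))))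
  have hSuf' := (hasMajorantHom_iff (g := toB6 g Rg Hg) blk Suf _).1
    (hasMajorantHom_rate_mono (R := Rg) (H := Hg) blk blk κT wT (ρ := r₀ - 5 * ε - asep) hκT hwT hrT hdnn ((hasMajorantHom_iff (g := toB6 g Rg Hg) blk Suf _).2 hSuf))
  -- the chain
  have h1 := chain_majorant_blk (Rg := Rg) (Hg := Hg) blk dB S_L wL wS hκL hκS hCS hwL hwS (by linarith) (show r₀ - ε + (α + β) * δ₀ ≤ r₀ by linarith)
    hdnn htri hSTS h261 hL hS'
  have h2 := chain_majorant_blk (Rg := Rg) (Hg := Hg) blk dB S_L (fun a => wL a * wS a) wA (by positivity) hκA hCA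
    (fun a => mul_nonneg (hwL a) (hwS a)) hwA (by linarith) (show r₀ - 2 * ε + (α + β) * δ₀ ≤ r₀ - ε by linarith) hdnn htri hSTA h261 h1 hA2
  have h3 := chain_majorant_blk (Rg := Rg) (Hg := Hg) blk dB S_L (fun a => wL a * wS a * wA a) wA (by positivity) hκA hCA
    (fun a => mul_nonneg (mul_nonneg (hwL a) (hwS a)) (hwA a)) hwA (by linarith) (show r₀ - 3 * ε + (α + β) * δ₀ ≤ r₀ - 2 * ε by linarith)
    hdnn htri hSTA h261 h2 hA3
  -- the separation: `(L S A A)·M_{m_Z}`, then `R_χ`, then the suffix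
  have h4 := word_far_majorant_blk (Rg := Rg) (Hg := Hg) blk dB S_L Z mZ (fun a => wL a * wS a * wA a * wA a) (fun _ => (1 : ℝ)) (by positivity) hθ zero_le_one
    (fun a => mul_nonneg (mul_nonneg (mul_nonneg (hwL a) (hwS a)) (hwA a)) (hwA a)) (fun _ => zero_le_one) (by linarith) hasep
    (show asep + (r₀ - 3 * ε - asep) ≤ r₀ - 3 * ε by linarith) (show r₀ - 4 * ε - asep + (α + β) * δ₀ ≤ r₀ - 3 * ε - asep by linarith)
    hdnn htri (scaleTransfer_one hαδ hdnn) h261 hm1 hm0 hsep h3 hRc'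
  rw [mul_assoc (L * Sop * Aop * Aop) (mulOp mZ) Rc, hRcZ] at h4
  have h5 := chain_majorant_blk (Rg := Rg) (Hg := Hg) blk dB S_L (fun a => wL a * wS a * wA a * wA a * 1) wT (by positivity) hκT hCT
    (fun a => mul_nonneg (mul_nonneg (mul_nonneg (mul_nonneg (hwL a) (hwS a)) (hwA a)) (hwA a)) zero_le_one) hwT hρ
    (show r₀ - 5 * ε - asep + (α + β) * δ₀ ≤ r₀ - 4 * ε - asep by linarith) hdnn htri hSTT h261 h4 hSuf'
  refine hasMajorant_mono (g := toB6 g Rg Hg) _ h5 fun (a b : g.Site) => le_of_eq ?_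
  simp only [hε]
  ring

/-- ★★ **WORD 4** `L·S·A·R_χ·Suf` (`Suf = (η²G′_□)·Tail`): as WORD 3 with one member propagator fewer:
`≺ 𝟙[a ∈ S_L]·(κ_Lκ_Sκ_Aθκ_T·C_SC_AC_T·c₁⁴·e^{−a_sepD_sep})·(w_Lw_Sw_Aw_T)(a)·e^{−(r₀ − 4ε − a_sep)d}`.
[cite: Balaban1985BackgroundPropagators, p.412 l.1–9 + l.22–36, p.415 l.29–37, (3.48)–(3.49) pp.398–399; Balaban1984PropagatorsII, (2.83)–(2.85) pp.237–238, (2.52)–(2.55) p.232, (2.60)–(2.61) p.234] -/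
theorem word4_majorant_blk (blk : X → g.Site) (dB : ℕ) (S_L Z : Finset g.Site) (mZ : X → ℝ) {L Sop Aop Rc Suf : Module.End ℝ (X → ℝ)}
    {κL κS κA θ κT r₀ rS rA rc rT δ₀ α β asep Dsep CS CA CT : ℝ} (wL wS wA wT : g.Site → ℝ)
    (hκL : 0 ≤ κL) (hκS : 0 ≤ κS) (hκA : 0 ≤ κA) (hθ : 0 ≤ θ) (hκT : 0 ≤ κT) (hCS : 0 ≤ CS) (hCA : 0 ≤ CA) (hCT : 0 ≤ CT)
    (hwL : ∀ a, 0 ≤ wL a) (hwS : ∀ a, 0 ≤ wS a) (hwA : ∀ a, 0 ≤ wA a) (hwT : ∀ a, 0 ≤ wT a)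
    (hαδ : 0 ≤ α * δ₀) (hε0 : 0 ≤ (α + β) * δ₀) (hasep : 0 ≤ asep) (hρ : 0 ≤ r₀ - 4 * ((α + β) * δ₀) - asep)
    (hrS : r₀ - (α + β) * δ₀ ≤ rS) (hrA : r₀ - 2 * ((α + β) * δ₀) ≤ rA) (hrc : r₀ - 3 * ((α + β) * δ₀) - asep ≤ rc)
    (hrT : r₀ - 4 * ((α + β) * δ₀) - asep ≤ rT)
    (hdnn : ∀ a b : g.Site, 0 ≤ g.dist a b) (htri : Triangle254 (toB6 g Rg Hg))
    (hSTS : ScaleTransfer g δ₀ α CS wS) (hSTA : ScaleTransfer g δ₀ α CA wA) (hSTT : ScaleTransfer g δ₀ α CT wT) (h261 : Ineq261 dB (toB6 g Rg Hg) δ₀ β)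
    (hm1 : ∀ x, |mZ x| ≤ 1) (hm0 : ∀ x, mZ x ≠ 0 → blk x ∈ Z) (hRcZ : mulOp mZ * Rc = Rc) (hsep : ∀ a ∈ S_L, ∀ y ∈ Z, Dsep ≤ g.dist a y)
    (hL : HasMajorant (g := toB6 g Rg Hg) blk L (fun (a b : g.Site) => (if a ∈ S_L then (1 : ℝ) else 0) * (κL * wL a * Real.exp (-(r₀ * g.dist a b)))))
    (hS : HasMajorant (g := toB6 g Rg Hg) blk Sop (fun (a b : g.Site) => κS * wS a * Real.exp (-(rS * g.dist a b))))
    (hA : HasMajorant (g := toB6 g Rg Hg) blk Aop (fun (a b : g.Site) => κA * wA a * Real.exp (-(rA * g.dist a b))))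
    (hRc : HasMajorant (g := toB6 g Rg Hg) blk Rc (fun (a b : g.Site) => θ * Real.exp (-(rc * g.dist a b))))
    (hSuf : HasMajorant (g := toB6 g Rg Hg) blk Suf (fun (a b : g.Site) => κT * wT a * Real.exp (-(rT * g.dist a b)))) :
    HasMajorant (g := toB6 g Rg Hg) blk (L * Sop * Aop * Rc * Suf)
      (fun (a b : g.Site) => (if a ∈ S_L then (1 : ℝ) else 0) *
        ((κL * κS * κA * θ * κT * (CS * CA * CT) * B6.c1 dB δ₀ β ^ 4 * Real.exp (-(asep * Dsep))) *
          (wL a * wS a * wA a * wT a) * Real.exp (-((r₀ - 4 * ((α + β) * δ₀) - asep) * g.dist a b)))) := by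
  set ε : ℝ := (α + β) * δ₀ with hε
  have hc1 : 0 ≤ B6.c1 dB δ₀ β := c1_nonneg _ _ _
  have hS' := (hasMajorantHom_iff (g := toB6 g Rg Hg) blk Sop _).1
    (hasMajorantHom_rate_mono (R := Rg) (H := Hg) blk blk κS wS (ρ := r₀ - ε) hκS hwS hrS hdnn ((hasMajorantHom_iff (g := toB6 g Rg Hg) blk Sop _).2 hS))
  have hA2 := (hasMajorantHom_iff (g := toB6 g Rg Hg) blk Aop _).1
    (hasMajorantHom_rate_mono (R := Rg) (H := Hg) blk blk κA wA (ρ := r₀ - 2 * ε) hκA hwA hrA hdnn ((hasMajorantHom_iff (g := toB6 g Rg Hg) blk Aop _).2 hA))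
  have hRc' : HasMajorant (g := toB6 g Rg Hg) blk Rc (fun (a b : g.Site) => θ * (fun _ => (1 : ℝ)) a * Real.exp (-((r₀ - 3 * ε - asep) * g.dist a b))) :=
    (hasMajorantHom_iff (g := toB6 g Rg Hg) blk Rc _).1
      (hasMajorantHom_rate_mono (R := Rg) (H := Hg) blk blk θ (fun _ => (1 : ℝ)) (ρ := r₀ - 3 * ε - asep) hθ (fun _ => zero_le_one) hrc hdnn
        ((hasMajorantHom_iff (g := toB6 g Rg Hg) blk Rc _).2 (hasMajorant_mono (g := toB6 g Rg Hg) _ hRc fun a b => le_of_eq (by simp only [mul_one]))))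
  have hSuf' := (hasMajorantHom_iff (g := toB6 g Rg Hg) blk Suf _).1
    (hasMajorantHom_rate_mono (R := Rg) (H := Hg) blk blk κT wT (ρ := r₀ - 4 * ε - asep) hκT hwT hrT hdnn ((hasMajorantHom_iff (g := toB6 g Rg Hg) blk Suf _).2 hSuf))
  have h1 := chain_majorant_blk (Rg := Rg) (Hg := Hg) blk dB S_L wL wS hκL hκS hCS hwL hwS (by linarith) (show r₀ - ε + (α + β) * δ₀ ≤ r₀ by linarith)
    hdnn htri hSTS h261 hL hS'
  have h2 := chain_majorant_blk (Rg := Rg) (Hg := Hg) blk dB S_L (fun a => wL a * wS a) wA (by positivity) hκA hCA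
    (fun a => mul_nonneg (hwL a) (hwS a)) hwA (by linarith) (show r₀ - 2 * ε + (α + β) * δ₀ ≤ r₀ - ε by linarith) hdnn htri hSTA h261 h1 hA2
  have h3 := word_far_majorant_blk (Rg := Rg) (Hg := Hg) blk dB S_L Z mZ (fun a => wL a * wS a * wA a) (fun _ => (1 : ℝ)) (by positivity) hθ zero_le_one
    (fun a => mul_nonneg (mul_nonneg (hwL a) (hwS a)) (hwA a)) (fun _ => zero_le_one) (by linarith) hasep
    (show asep + (r₀ - 2 * ε - asep) ≤ r₀ - 2 * ε by linarith) (show r₀ - 3 * ε - asep + (α + β) * δ₀ ≤ r₀ - 2 * ε - asep by linarith)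
    hdnn htri (scaleTransfer_one hαδ hdnn) h261 hm1 hm0 hsep h2 hRc'
  rw [mul_assoc (L * Sop * Aop) (mulOp mZ) Rc, hRcZ] at h3
  have h4 := chain_majorant_blk (Rg := Rg) (Hg := Hg) blk dB S_L (fun a => wL a * wS a * wA a * 1) wT (by positivity) hκT hCT
    (fun a => mul_nonneg (mul_nonneg (mul_nonneg (hwL a) (hwS a)) (hwA a)) zero_le_one) hwT hρ
    (show r₀ - 4 * ε - asep + (α + β) * δ₀ ≤ r₀ - 3 * ε - asep by linarith) hdnn htri hSTT h261 h3 hSuf'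
  refine hasMajorant_mono (g := toB6 g Rg Hg) _ h4 fun (a b : g.Site) => le_of_eq ?_
  simp only [hε]
  ring

/-- ★★ **WORD 2** `L·S·A·A·M_m·P·Suf` (`Suf = Tail`): the far cut-off `m = 1 − χ_□` (support `Z`, off the `3S_j`-plateau) at distance `≥ D_sep` from `S_L`, the member
projection `P = Q′*Q′(U₁)` block-local (`≺ κ_P𝟙[a = a′]`):
`≺ 𝟙[a ∈ S_L]·(κ_Lκ_Sκ_A²κ_Pκ_T·C_SC_A²C_T·c₁⁴·e^{−a_sepD_sep})·(w_Lw_Sw_A²w_T)(a)·e^{−(r₀ − 4ε − a_sep)d}`.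
[cite: Balaban1985BackgroundPropagators, p.412 l.22–36, p.415 l.29–37, (3.19)–(3.21) pp.393–394, (3.48)–(3.49) pp.398–399; Balaban1984PropagatorsII, (2.83)–(2.85) pp.237–238, (2.52)–(2.55) p.232, (2.60)–(2.61) p.234] -/
theorem word2_majorant_blk (blk : X → g.Site) (dB : ℕ) (S_L Z : Finset g.Site) (m : X → ℝ) {L Sop Aop P Suf : Module.End ℝ (X → ℝ)}
    {κL κS κA κP κT r₀ rS rA rT δ₀ α β asep Dsep CS CA CT : ℝ} (wL wS wA wT : g.Site → ℝ)
    (hκL : 0 ≤ κL) (hκS : 0 ≤ κS) (hκA : 0 ≤ κA) (hκP : 0 ≤ κP) (hκT : 0 ≤ κT) (hCS : 0 ≤ CS) (hCA : 0 ≤ CA) (hCT : 0 ≤ CT)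
    (hwL : ∀ a, 0 ≤ wL a) (hwS : ∀ a, 0 ≤ wS a) (hwA : ∀ a, 0 ≤ wA a) (hwT : ∀ a, 0 ≤ wT a)
    (hε0 : 0 ≤ (α + β) * δ₀) (hasep : 0 ≤ asep) (hρ : 0 ≤ r₀ - 4 * ((α + β) * δ₀) - asep)
    (hrS : r₀ - (α + β) * δ₀ ≤ rS) (hrA : r₀ - 2 * ((α + β) * δ₀) ≤ rA) (hrT : r₀ - 4 * ((α + β) * δ₀) - asep ≤ rT)
    (hdnn : ∀ a b : g.Site, 0 ≤ g.dist a b) (htri : Triangle254 (toB6 g Rg Hg))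
    (hSTS : ScaleTransfer g δ₀ α CS wS) (hSTA : ScaleTransfer g δ₀ α CA wA) (hSTT : ScaleTransfer g δ₀ α CT wT) (h261 : Ineq261 dB (toB6 g Rg Hg) δ₀ β)
    (hm1 : ∀ x, |m x| ≤ 1) (hm0 : ∀ x, m x ≠ 0 → blk x ∈ Z) (hsep : ∀ a ∈ S_L, ∀ y ∈ Z, Dsep ≤ g.dist a y)
    (hL : HasMajorant (g := toB6 g Rg Hg) blk L (fun (a b : g.Site) => (if a ∈ S_L then (1 : ℝ) else 0) * (κL * wL a * Real.exp (-(r₀ * g.dist a b)))))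
    (hS : HasMajorant (g := toB6 g Rg Hg) blk Sop (fun (a b : g.Site) => κS * wS a * Real.exp (-(rS * g.dist a b))))
    (hA : HasMajorant (g := toB6 g Rg Hg) blk Aop (fun (a b : g.Site) => κA * wA a * Real.exp (-(rA * g.dist a b))))
    (hP : HasMajorant (g := toB6 g Rg Hg) blk P (fun a b : g.Site => if a = b then κP else 0))
    (hSuf : HasMajorant (g := toB6 g Rg Hg) blk Suf (fun (a b : g.Site) => κT * wT a * Real.exp (-(rT * g.dist a b)))) :
    HasMajorant (g := toB6 g Rg Hg) blk (L * Sop * Aop * Aop * mulOp m * P * Suf)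
      (fun (a b : g.Site) => (if a ∈ S_L then (1 : ℝ) else 0) *
        ((κL * κS * κA ^ 2 * κP * κT * (CS * CA ^ 2 * CT) * B6.c1 dB δ₀ β ^ 4 * Real.exp (-(asep * Dsep))) *
          (wL a * wS a * wA a ^ 2 * wT a) * Real.exp (-((r₀ - 4 * ((α + β) * δ₀) - asep) * g.dist a b)))) := by
  set ε : ℝ := (α + β) * δ₀ with hε
  have hc1 : 0 ≤ B6.c1 dB δ₀ β := c1_nonneg _ _ _
  have hS' := (hasMajorantHom_iff (g := toB6 g Rg Hg) blk Sop _).1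
    (hasMajorantHom_rate_mono (R := Rg) (H := Hg) blk blk κS wS (ρ := r₀ - ε) hκS hwS hrS hdnn ((hasMajorantHom_iff (g := toB6 g Rg Hg) blk Sop _).2 hS))
  have hA2 := (hasMajorantHom_iff (g := toB6 g Rg Hg) blk Aop _).1
    (hasMajorantHom_rate_mono (R := Rg) (H := Hg) blk blk κA wA (ρ := r₀ - 2 * ε) hκA hwA hrA hdnn ((hasMajorantHom_iff (g := toB6 g Rg Hg) blk Aop _).2 hA))
  have hA3 := (hasMajorantHom_iff (g := toB6 g Rg Hg) blk Aop _).1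
    (hasMajorantHom_rate_mono (R := Rg) (H := Hg) blk blk κA wA (ρ := r₀ - 3 * ε) hκA hwA (by linarith) hdnn
      ((hasMajorantHom_iff (g := toB6 g Rg Hg) blk Aop _).2 hA))
  have hSuf' := (hasMajorantHom_iff (g := toB6 g Rg Hg) blk Suf _).1
    (hasMajorantHom_rate_mono (R := Rg) (H := Hg) blk blk κT wT (ρ := r₀ - 4 * ε - asep) hκT hwT hrT hdnn ((hasMajorantHom_iff (g := toB6 g Rg Hg) blk Suf _).2 hSuf))
  have h1 := chain_majorant_blk (Rg := Rg) (Hg := Hg) blk dB S_L wL wS hκL hκS hCS hwL hwS (by linarith) (show r₀ - ε + (α + β) * δ₀ ≤ r₀ by linarith)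
    hdnn htri hSTS h261 hL hS'
  have h2 := chain_majorant_blk (Rg := Rg) (Hg := Hg) blk dB S_L (fun a => wL a * wS a) wA (by positivity) hκA hCA
    (fun a => mul_nonneg (hwL a) (hwS a)) hwA (by linarith) (show r₀ - 2 * ε + (α + β) * δ₀ ≤ r₀ - ε by linarith) hdnn htri hSTA h261 h1 hA2
  have h3 := chain_majorant_blk (Rg := Rg) (Hg := Hg) blk dB S_L (fun a => wL a * wS a * wA a) wA (by positivity) hκA hCA
    (fun a => mul_nonneg (mul_nonneg (hwL a) (hwS a)) (hwA a)) hwA (by linarith) (show r₀ - 3 * ε + (α + β) * δ₀ ≤ r₀ - 2 * ε by linarith)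
    hdnn htri hSTA h261 h2 hA3
  -- the separation, the local projection, the suffix
  have h4 := rowSep_majorant_blk (Rg := Rg) (Hg := Hg) blk (fun a => wL a * wS a * wA a * wA a) S_L Z m (by positivity)
    (fun a => mul_nonneg (mul_nonneg (mul_nonneg (hwL a) (hwS a)) (hwA a)) (hwA a)) hasep (show asep + (r₀ - 3 * ε - asep) ≤ r₀ - 3 * ε by linarith)
    hdnn hm1 hm0 hsep h3
  have h5 := chain_local_majorant_blk (Rg := Rg) (Hg := Hg) blk S_L (fun a => wL a * wS a * wA a * wA a) hκP h4 hP
  have h6 := chain_majorant_blk (Rg := Rg) (Hg := Hg) blk dB S_L (fun a => wL a * wS a * wA a * wA a) wT (by positivity) hκT hCT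
    (fun a => mul_nonneg (mul_nonneg (mul_nonneg (hwL a) (hwS a)) (hwA a)) (hwA a)) hwT hρ
    (show r₀ - 4 * ε - asep + (α + β) * δ₀ ≤ r₀ - 3 * ε - asep by linarith) hdnn htri hSTT h261 h5 hSuf'
  refine hasMajorant_mono (g := toB6 g Rg Hg) _ h6 fun (a b : g.Site) => le_of_eq ?_
  simp only [hε]
  ring

/-- ★★ **WORD 1** `L·S·P_□·M_m·Suf` (`Suf = (η²G′_□)²·Tail`): the cube projection `P_□ = Q′*_□Q′_□(V′)` block-local on the member's carrier (`≺ κ_P𝟙[a = a′]`,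
`hasMajorant_diag_coarsen`), the far cut-off `m = 1 − χ_□` at distance `≥ D_sep` from `S_L`:
`≺ 𝟙[a ∈ S_L]·(κ_Lκ_Sκ_Pκ_T·C_SC_T·c₁²·e^{−a_sepD_sep})·(w_Lw_Sw_T)(a)·e^{−(r₀ − 2ε − a_sep)d}`.
[cite: Balaban1985BackgroundPropagators, p.412 l.22–36, p.415 l.29–37, (3.19)–(3.21) pp.393–394, (3.48)–(3.49) pp.398–399; Balaban1984PropagatorsII, (2.83)–(2.85) pp.237–238, (2.52)–(2.55) p.232, (2.60)–(2.61) p.234] -/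
theorem word1_majorant_blk (blk : X → g.Site) (dB : ℕ) (S_L Z : Finset g.Site) (m : X → ℝ) {L Sop Pb Suf : Module.End ℝ (X → ℝ)}
    {κL κS κP κT r₀ rS rT δ₀ α β asep Dsep CS CT : ℝ} (wL wS wT : g.Site → ℝ)
    (hκL : 0 ≤ κL) (hκS : 0 ≤ κS) (hκP : 0 ≤ κP) (hκT : 0 ≤ κT) (hCS : 0 ≤ CS) (hCT : 0 ≤ CT)
    (hwL : ∀ a, 0 ≤ wL a) (hwS : ∀ a, 0 ≤ wS a) (hwT : ∀ a, 0 ≤ wT a)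
    (hε0 : 0 ≤ (α + β) * δ₀) (hasep : 0 ≤ asep) (hρ : 0 ≤ r₀ - 2 * ((α + β) * δ₀) - asep)
    (hrS : r₀ - (α + β) * δ₀ ≤ rS) (hrT : r₀ - 2 * ((α + β) * δ₀) - asep ≤ rT)
    (hdnn : ∀ a b : g.Site, 0 ≤ g.dist a b) (htri : Triangle254 (toB6 g Rg Hg))
    (hSTS : ScaleTransfer g δ₀ α CS wS) (hSTT : ScaleTransfer g δ₀ α CT wT) (h261 : Ineq261 dB (toB6 g Rg Hg) δ₀ β)
    (hm1 : ∀ x, |m x| ≤ 1) (hm0 : ∀ x, m x ≠ 0 → blk x ∈ Z) (hsep : ∀ a ∈ S_L, ∀ y ∈ Z, Dsep ≤ g.dist a y)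
    (hL : HasMajorant (g := toB6 g Rg Hg) blk L (fun (a b : g.Site) => (if a ∈ S_L then (1 : ℝ) else 0) * (κL * wL a * Real.exp (-(r₀ * g.dist a b)))))
    (hS : HasMajorant (g := toB6 g Rg Hg) blk Sop (fun (a b : g.Site) => κS * wS a * Real.exp (-(rS * g.dist a b))))
    (hPb : HasMajorant (g := toB6 g Rg Hg) blk Pb (fun a b : g.Site => if a = b then κP else 0))
    (hSuf : HasMajorant (g := toB6 g Rg Hg) blk Suf (fun (a b : g.Site) => κT * wT a * Real.exp (-(rT * g.dist a b)))) :
    HasMajorant (g := toB6 g Rg Hg) blk (L * Sop * Pb * mulOp m * Suf)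
      (fun (a b : g.Site) => (if a ∈ S_L then (1 : ℝ) else 0) *
        ((κL * κS * κP * κT * (CS * CT) * B6.c1 dB δ₀ β ^ 2 * Real.exp (-(asep * Dsep))) *
          (wL a * wS a * wT a) * Real.exp (-((r₀ - 2 * ((α + β) * δ₀) - asep) * g.dist a b)))) := by
  set ε : ℝ := (α + β) * δ₀ with hε
  have hc1 : 0 ≤ B6.c1 dB δ₀ β := c1_nonneg _ _ _
  have hS' := (hasMajorantHom_iff (g := toB6 g Rg Hg) blk Sop _).1
    (hasMajorantHom_rate_mono (R := Rg) (H := Hg) blk blk κS wS (ρ := r₀ - ε) hκS hwS hrS hdnn ((hasMajorantHom_iff (g := toB6 g Rg Hg) blk Sop _).2 hS))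
  have hSuf' := (hasMajorantHom_iff (g := toB6 g Rg Hg) blk Suf _).1
    (hasMajorantHom_rate_mono (R := Rg) (H := Hg) blk blk κT wT (ρ := r₀ - 2 * ε - asep) hκT hwT hrT hdnn ((hasMajorantHom_iff (g := toB6 g Rg Hg) blk Suf _).2 hSuf))
  have h1 := chain_majorant_blk (Rg := Rg) (Hg := Hg) blk dB S_L wL wS hκL hκS hCS hwL hwS (by linarith) (show r₀ - ε + (α + β) * δ₀ ≤ r₀ by linarith)
    hdnn htri hSTS h261 hL hS'
  have h2 := chain_local_majorant_blk (Rg := Rg) (Hg := Hg) blk S_L (fun a => wL a * wS a) hκP h1 hPb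
  have h3 := word_far_majorant_blk (Rg := Rg) (Hg := Hg) blk dB S_L Z m (fun a => wL a * wS a) wT (by positivity) hκT hCT
    (fun a => mul_nonneg (hwL a) (hwS a)) hwT hρ hasep (show asep + (r₀ - ε - asep) ≤ r₀ - ε by linarith)
    (show r₀ - 2 * ε - asep + (α + β) * δ₀ ≤ r₀ - ε - asep by linarith) hdnn htri hSTT h261 hm1 hm0 hsep h2 hSuf'
  refine hasMajorant_mono (g := toB6 g Rg Hg) _ h3 fun (a b : g.Site) => le_of_eq ?_
  simp only [hε]
  ring

/-- ★ **A LEAK** `L·X·M_m·Suf` (p38's `sandwich_split` side words: `X = M₂·S` or `M₂·S_□` with near rows, `m = 1 − 𝟙[NearC 3S_j]`, `Suf` the right entry; or `X = 1`):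
`≺ 𝟙[a ∈ S_L]·(κ_Lκ_Xκ_T·C_XC_T·c₁²·e^{−a_sepD_sep})·(w_Lw_Xw_T)(a)·e^{−(r₀ − 2ε − a_sep)d}`.
[cite: Balaban1985BackgroundPropagators, p.412 l.22–36, p.415 l.26–37; Balaban1984PropagatorsII, (2.83)–(2.85) pp.237–238, (2.52)–(2.55) p.232, (2.60)–(2.61) p.234] -/
theorem leak_majorant_blk (blk : X → g.Site) (dB : ℕ) (S_L Z : Finset g.Site) (m : X → ℝ) {L Xop Suf : Module.End ℝ (X → ℝ)}
    {κL κX κT r₀ rX rT δ₀ α β asep Dsep CX CT : ℝ} (wL wX wT : g.Site → ℝ)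
    (hκL : 0 ≤ κL) (hκX : 0 ≤ κX) (hκT : 0 ≤ κT) (hCX : 0 ≤ CX) (hCT : 0 ≤ CT)
    (hwL : ∀ a, 0 ≤ wL a) (hwX : ∀ a, 0 ≤ wX a) (hwT : ∀ a, 0 ≤ wT a)
    (hε0 : 0 ≤ (α + β) * δ₀) (hasep : 0 ≤ asep) (hρ : 0 ≤ r₀ - 2 * ((α + β) * δ₀) - asep)
    (hrX : r₀ - (α + β) * δ₀ ≤ rX) (hrT : r₀ - 2 * ((α + β) * δ₀) - asep ≤ rT)
    (hdnn : ∀ a b : g.Site, 0 ≤ g.dist a b) (htri : Triangle254 (toB6 g Rg Hg))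
    (hSTX : ScaleTransfer g δ₀ α CX wX) (hSTT : ScaleTransfer g δ₀ α CT wT) (h261 : Ineq261 dB (toB6 g Rg Hg) δ₀ β)
    (hm1 : ∀ x, |m x| ≤ 1) (hm0 : ∀ x, m x ≠ 0 → blk x ∈ Z) (hsep : ∀ a ∈ S_L, ∀ y ∈ Z, Dsep ≤ g.dist a y)
    (hL : HasMajorant (g := toB6 g Rg Hg) blk L (fun (a b : g.Site) => (if a ∈ S_L then (1 : ℝ) else 0) * (κL * wL a * Real.exp (-(r₀ * g.dist a b)))))
    (hX : HasMajorant (g := toB6 g Rg Hg) blk Xop (fun (a b : g.Site) => κX * wX a * Real.exp (-(rX * g.dist a b))))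
    (hSuf : HasMajorant (g := toB6 g Rg Hg) blk Suf (fun (a b : g.Site) => κT * wT a * Real.exp (-(rT * g.dist a b)))) :
    HasMajorant (g := toB6 g Rg Hg) blk (L * Xop * mulOp m * Suf)
      (fun (a b : g.Site) => (if a ∈ S_L then (1 : ℝ) else 0) *
        ((κL * κX * κT * (CX * CT) * B6.c1 dB δ₀ β ^ 2 * Real.exp (-(asep * Dsep))) *
          (wL a * wX a * wT a) * Real.exp (-((r₀ - 2 * ((α + β) * δ₀) - asep) * g.dist a b)))) := by
  set ε : ℝ := (α + β) * δ₀ with hε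
  have hc1 : 0 ≤ B6.c1 dB δ₀ β := c1_nonneg _ _ _
  have hX' := (hasMajorantHom_iff (g := toB6 g Rg Hg) blk Xop _).1
    (hasMajorantHom_rate_mono (R := Rg) (H := Hg) blk blk κX wX (ρ := r₀ - ε) hκX hwX hrX hdnn ((hasMajorantHom_iff (g := toB6 g Rg Hg) blk Xop _).2 hX))
  have hSuf' := (hasMajorantHom_iff (g := toB6 g Rg Hg) blk Suf _).1
    (hasMajorantHom_rate_mono (R := Rg) (H := Hg) blk blk κT wT (ρ := r₀ - 2 * ε - asep) hκT hwT hrT hdnn ((hasMajorantHom_iff (g := toB6 g Rg Hg) blk Suf _).2 hSuf))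
  have h1 := chain_majorant_blk (Rg := Rg) (Hg := Hg) blk dB S_L wL wX hκL hκX hCX hwL hwX (by linarith) (show r₀ - ε + (α + β) * δ₀ ≤ r₀ by linarith)
    hdnn htri hSTX h261 hL hX'
  have h2 := word_far_majorant_blk (Rg := Rg) (Hg := Hg) blk dB S_L Z m (fun a => wL a * wX a) wT (by positivity) hκT hCT
    (fun a => mul_nonneg (hwL a) (hwX a)) hwT hρ hasep (show asep + (r₀ - ε - asep) ≤ r₀ - ε by linarith)
    (show r₀ - 2 * ε - asep + (α + β) * δ₀ ≤ r₀ - ε - asep by linarith) hdnn htri hSTT h261 hm1 hm0 hsep h1 hSuf'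
  refine hasMajorant_mono (g := toB6 g Rg Hg) _ h2 fun (a b : g.Site) => le_of_eq ?_
  simp only [hε]
  ring

end Generic

end Literature.MathematicalPhysics.QuantumFieldTheory.Balaban1983to89.B9Eq3105FamThreeLocCDiffChains
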